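import Summits.HodgeConjecture.HodgeConjecture.Theses.CyclicUnitaryPowers
import Summits.HodgeConjecture.HodgeConjecture.Theorems.CyclicUnitaryPowersDeckUnitaryCommutatorsFix
import Summits.HodgeConjecture.HodgeConjecture.Theorems.CyclicUnitaryPowersDeckUnitaryGeneration
import Summits.HodgeConjecture.HodgeConjecture.Theorems.CyclicUnitaryPowersDeckUnitaryCayleyAscent

/-!
# Stub D₂ `stub_deckUnitaryCommutatorGeneration` of crux K2-A (stmt-HodgeConjecture-19545), by name

The registered stub D₂ of line `unitary-kunneth-fft` v5 (dd8298dd): from the conclusion of stub D₁ (commutators of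
Cayley-reachable `s_ℂ`-commuting `Q_ℂ`-isometries fix `ι t`), EVERY element `γ` of the connected deck-unitary group
`U⁰(ℂ)` (commuting with `s_ℂ`, preserving `Q_ℂ`, fixing the `s_ℂ`-fixed vectors) whose blocks on the eigenspaces
`E_j = range P_j` (`1 ≤ j < p`) have determinant `1` fixes `ι t`.  Proof = D₂a
(`CyclicUnitaryPowersDeckUnitaryCommutatorsFix`: every commutator of `U⁰(ℂ)` fixes `ι t`, via Cayley parameters,
`Ω·Ω ⊇ U⁰` and bootstrapping) + D₂b (`CyclicUnitaryPowersDeckUnitaryGeneration.mem_of_det_block_eq_one`: elements with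
determinant-one blocks are products of commutators, via the `B`-dual block extension and `SL_n ⊆ [GL_n, GL_n]`).
No Zariski closure, no algebraic-group toolkit; Maillet/Hodge theory enter only in stubs T, L.
-/

noncomputable section

open Module
open scoped TensorProduct BigOperators

namespace Summit.HodgeConjecture.HodgeConjecture.Theorems.CyclicUnitaryPowersDeckUnitaryCommutatorGeneration

open Literature.AlgebraicGeometry.Motives
open Summit.HodgeConjecture.HodgeConjecture.Theorems.CyclicUnitaryPowersSpectralProjectors
open Summit.HodgeConjecture.HodgeConjecture.Theorems.CyclicUnitaryPowersDeckUnitaryGroup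
open Summit.HodgeConjecture.HodgeConjecture.Theorems.CyclicUnitaryPowersDeckUnitaryCommutatorsFix
open Summit.HodgeConjecture.HodgeConjecture.Theorems.CyclicUnitaryPowersDeckUnitaryGeneration
open Summit.HodgeConjecture.HodgeConjecture.Theorems.CyclicUnitaryPowersDeckUnitaryCayleyAscent

/-- `Q_ℂ` is symmetric if `Q` is. [folklore] -/
theorem baseChange_symm {V : Type} [AddCommGroup V] [Module ℚ V] (Q : LinearMap.BilinForm ℚ V)
    (hQs : ∀ x y, Q x y = Q y x) (x y : ℂ ⊗[ℚ] V) : (Q.baseChange ℂ) x y = (Q.baseChange ℂ) y x := by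
  induction x using TensorProduct.induction_on generalizing y with
  | zero => simp
  | tmul a v =>
    induction y using TensorProduct.induction_on with
    | zero => simp
    | tmul a' v' => rw [LinearMap.BilinForm.baseChange_tmul, LinearMap.BilinForm.baseChange_tmul, hQs, mul_comm]
    | add y₁ y₂ h₁ h₂ => rw [map_add, map_add, LinearMap.add_apply, h₁, h₂]
  | add x₁ x₂ h₁ h₂ => rw [map_add, LinearMap.add_apply, h₁, h₂, map_add]

/-- `Q_ℂ` is nondegenerate if `Q` is (finite-dimensional `V`). [folklore] -/
theorem baseChange_nondegenerate {V : Type} [AddCommGroup V] [Module ℚ V] [Module.Finite ℚ V]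
    (Q : LinearMap.BilinForm ℚ V) (hQ : Q.Nondegenerate) : (Q.baseChange ℂ).Nondegenerate := by
  set b := Module.finBasis ℚ V
  rw [LinearMap.BilinForm.nondegenerate_iff_det_ne_zero (Algebra.TensorProduct.basis ℂ b),
    toMatrix_bilin_baseChange_eq ℂ b Q, ← RingHom.mapMatrix_apply, ← RingHom.map_det]
  exact (map_ne_zero_iff _ (algebraMap ℚ ℂ).injective).mpr
    ((LinearMap.BilinForm.nondegenerate_iff_det_ne_zero b).mp hQ)

/-- **Stub D₂ `stub_deckUnitaryCommutatorGeneration`** (K2-A skeleton v5, stmt-HodgeConjecture-19545), registered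
signature verbatim. [cite: GoodmanWallachGTM255, §2.2.3 Exercise 1] -/
theorem stub_deckUnitaryCommutatorGeneration :
    open Literature.AlgebraicGeometry.Motives Literature.AlgebraicGeometry.HodgeTheory Literature.AlgebraicGeometry.HodgeTheory.BettiUniverse CategoryTheory.Limits in ∀ (V : Type) [AddCommGroup V] [Module ℚ V] [Module.Finite ℚ V] (Q : LinearMap.BilinForm ℚ V) (s : V →ₗ[ℚ] V) (p : ℕ), p.Prime → 3 ≤ p → Q.Nondegenerate → (∀ x y, Q x y = Q y x) → s ^ p = 1 → (∀ x y, Q (s x) (s y) = Q x y) → Module.finrank ℚ ↥(Module.End.eigenspace s 1) = 1 → ∀ (ζ : ℂ), IsPrimitiveRoot ζ p → ∀ (r : ℕ) (t : hodgeTensorSpace V r 0), (∀ γ δ : (ℂ ⊗[ℚ] V) ≃ₗ[ℂ] (ℂ ⊗[ℚ] V), (∀ x, γ ((s.baseChange ℂ) x) = (s.baseChange ℂ) (γ x)) → (∀ x y, (LinearMap.BilinForm.baseChange ℂ Q) (γ x) (γ y) = (LinearMap.BilinForm.baseChange ℂ Q) x y) → (∀ x, δ ((s.baseChange ℂ) x)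 = (s.baseChange ℂ) (δ x)) → (∀ x y, (LinearMap.BilinForm.baseChange ℂ Q) (δ x) (δ y) = (LinearMap.BilinForm.baseChange ℂ Q) x y) → IsUnit (LinearMap.det (((γ : (ℂ ⊗[ℚ] V) ≃ₗ[ℂ] (ℂ ⊗[ℚ] V)) : (ℂ ⊗[ℚ] V) →ₗ[ℂ] (ℂ ⊗[ℚ] V)) + 1)) → IsUnit (LinearMap.det (((δ : (ℂ ⊗[ℚ] V) ≃ₗ[ℂ] (ℂ ⊗[ℚ] V)) : (ℂ ⊗[ℚ] V) →ₗ[ℂ] (ℂ ⊗[ℚ] V)) + 1)) → tensorSpaceActOver (γ * δ * γ⁻¹ * δ⁻¹) (tensorSpaceToBaseChange ℂ V r 0 t) = (tensorSpaceToBaseChange ℂ V r 0 t)) → (∀ γ : (ℂ ⊗[ℚ] V) ≃ₗ[ℂ] (ℂ ⊗[ℚ] V), (∀ x, γ ((s.baseChange ℂ) x) = (s.baseChange ℂ) (γ x)) → (∀ x y, (LinearMap.BilinForm.baseChange ℂ Q) (γ x) (γ y) = (LinearMap.BilinForm.baseChange ℂ Q) x y) → (∀ x, (s.baseChange ℂ)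 x = x → γ x = x) → (∀ j ∈ Finset.Ico 1 p, LinearMap.det (((γ : (ℂ ⊗[ℚ] V) ≃ₗ[ℂ] (ℂ ⊗[ℚ] V)) : (ℂ ⊗[ℚ] V) →ₗ[ℂ] (ℂ ⊗[ℚ] V)) ∘ₗ (((p : ℂ)⁻¹) • ∑ i ∈ Finset.range p, (((ζ) ^ (i * j))⁻¹) • (s.baseChange ℂ) ^ i) + (1 - (((p : ℂ)⁻¹) • ∑ i ∈ Finset.range p, (((ζ) ^ (i * j))⁻¹) • (s.baseChange ℂ) ^ i))) = 1) → tensorSpaceActOver γ (tensorSpaceToBaseChange ℂ V r 0 t) = (tensorSpaceToBaseChange ℂ V r 0 t)) := by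
  intro V _ _ _ Q s p hp h3 hQ hQs hsp hsQ _hfin ζ hζ r t hD1 γ hγs hγQ hγfix hdet
  have hσ := baseChange_pow_eq_one s hsp
  have hB := baseChange_isometry Q s hsQ
  have hBs := baseChange_symm Q hQs
  have hBn := baseChange_nondegenerate Q hQ
  have hodd : Odd p := hp.odd_of_ne_two (by omega)
  have h2 : (2 : ℂ) ≠ 0 := two_ne_zero
  have hγ : γ ∈ centIso (s.baseChange ℂ) (Q.baseChange ℂ) := ⟨hγs, hγQ, hγfix⟩
  have hmem := mem_of_det_block_eq_one (ζ := ζ) hσ hζ hp.pos hodd hB hBn hBs h2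
    (stabilizerOf (tensorSpaceToBaseChange ℂ V r 0 t))
    (fun a ha b hb => tensorSpaceActOver_commutator_eq_of_cayleyReachable Q s hp h3 hsp hsQ hζ t hD1 a b
      ha.1 ha.2.1 ha.2.2 hb.1 hb.2.1 hb.2.2)
    hγ (fun j hj1 hjp => hdet j (Finset.mem_Ico.mpr ⟨hj1, hjp⟩))
  exact hmem

/-- **Stub D₂b `stub_deckUnitaryCommutatorSL`** (K2-A skeleton v6 e821e163, stmt-HodgeConjecture-19545), registered
signature verbatim: the `SL` layer alone — if every commutator of `U⁰(ℂ)` fixes `ι t`, then every element of `U⁰(ℂ)` with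
determinant-one blocks fixes `ι t`. [cite: GoodmanWallachGTM255, §2.2.3 Exercise 1] -/
theorem stub_deckUnitaryCommutatorSL :
    open Literature.AlgebraicGeometry.Motives Literature.AlgebraicGeometry.HodgeTheory Literature.AlgebraicGeometry.HodgeTheory.BettiUniverse CategoryTheory.Limits in ∀ (V : Type) [AddCommGroup V] [Module ℚ V] [Module.Finite ℚ V] (Q : LinearMap.BilinForm ℚ V) (s : V →ₗ[ℚ] V) (p : ℕ), p.Prime → 3 ≤ p → Q.Nondegenerate → (∀ x y, Q x y = Q y x) → s ^ p = 1 → (∀ x y, Q (s x) (s y) = Q x y) → Module.finrank ℚ ↥(Module.End.eigenspace s 1) = 1 → ∀ (ζ : ℂ), IsPrimitiveRoot ζ p → ∀ (r : ℕ) (t : hodgeTensorSpace V r 0), (∀ γ δ : (ℂ ⊗[ℚ] V) ≃ₗ[ℂ] (ℂ ⊗[ℚ] V), (∀ x, γ ((s.baseChange ℂ) x) = (s.baseChange ℂ) (γ x)) → (∀ x y, (LinearMap.BilinForm.baseChange ℂ Q) (γ x) (γ y) = (LinearMap.BilinForm.baseChange ℂ Q) x y) → (∀ x, (s.baseChange ℂ)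 x = x → γ x = x) → (∀ x, δ ((s.baseChange ℂ) x) = (s.baseChange ℂ) (δ x)) → (∀ x y, (LinearMap.BilinForm.baseChange ℂ Q) (δ x) (δ y) = (LinearMap.BilinForm.baseChange ℂ Q) x y) → (∀ x, (s.baseChange ℂ) x = x → δ x = x) → tensorSpaceActOver (γ * δ * γ⁻¹ * δ⁻¹) (tensorSpaceToBaseChange ℂ V r 0 t) = (tensorSpaceToBaseChange ℂ V r 0 t)) → (∀ γ : (ℂ ⊗[ℚ] V) ≃ₗ[ℂ] (ℂ ⊗[ℚ] V), (∀ x, γ ((s.baseChange ℂ) x) = (s.baseChange ℂ) (γ x)) → (∀ x y, (LinearMap.BilinForm.baseChange ℂ Q) (γ x) (γ y) = (LinearMap.BilinForm.baseChange ℂ Q) x y) → (∀ x, (s.baseChange ℂ) x = x → γ x = x) → (∀ j ∈ Finset.Ico 1 p, LinearMap.det (((γ : (ℂ ⊗[ℚ] V) ≃ₗ[ℂ] (ℂ ⊗[ℚ] V)) : (ℂ ⊗[ℚ] V) →ₗ[ℂ] (ℂ ⊗[ℚ] V)) ∘ₗ (((p : ℂ)⁻¹) • ∑ i ∈ Finset.range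 p, (((ζ) ^ (i * j))⁻¹) • (s.baseChange ℂ) ^ i) + (1 - (((p : ℂ)⁻¹) • ∑ i ∈ Finset.range p, (((ζ) ^ (i * j))⁻¹) • (s.baseChange ℂ) ^ i))) = 1) → tensorSpaceActOver γ (tensorSpaceToBaseChange ℂ V r 0 t) = (tensorSpaceToBaseChange ℂ V r 0 t)) := by
  intro V _ _ _ Q s p hp h3 hQ hQs hsp hsQ _hfin ζ hζ r t hcomm γ hγs hγQ hγfix hdet
  have hσ := baseChange_pow_eq_one s hsp
  have hB := baseChange_isometry Q s hsQ
  have hBs := baseChange_symm Q hQs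
  have hBn := baseChange_nondegenerate Q hQ
  have hodd : Odd p := hp.odd_of_ne_two (by omega)
  have h2 : (2 : ℂ) ≠ 0 := two_ne_zero
  have hγ : γ ∈ centIso (s.baseChange ℂ) (Q.baseChange ℂ) := ⟨hγs, hγQ, hγfix⟩
  have hmem := mem_of_det_block_eq_one (ζ := ζ) hσ hζ hp.pos hodd hB hBn hBs h2
    (stabilizerOf (tensorSpaceToBaseChange ℂ V r 0 t))
    (fun a ha b hb => hcomm a b ha.1 ha.2.1 ha.2.2 hb.1 hb.2.1 hb.2.2)
    hγ (fun j hj1 hjp => hdet j (Finset.mem_Ico.mpr ⟨hj1, hjp⟩))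
  exact hmem

end Summit.HodgeConjecture.HodgeConjecture.Theorems.CyclicUnitaryPowersDeckUnitaryCommutatorGeneration

end
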